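import Summits.AtomisticToContinuum.Crystallization.Theses.DisclinationRation
import Summits.AtomisticToContinuum.Crystallization.Theorems.HullExactificationCascadeHullGoodEverywhereDefs
import Literature.MathematicalPhysics.StatisticalMechanics.LocalMatchingCompactness
import HarnessLib

/-!
# Birth skeleton (BC3) for crux `HullGlue` — item stmt-AtomisticToContinuum-15802,
# route `DisclinationRation` (rank 9, glue crux, difficulty L)

Crux (verbatim the route decl, concluded BY NAME below): for a sequence `x` of Lennard-Jones ground
states and a hull element `S` of `x` (two-way matched with translates of `x (φ j)` on every ball,
eventually in `j`) that is `δ`-separated, relatively dense and everywhere alphabet-good, IF the points of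
`S` that are not `1/20`-{fcc,hcp}-good have density zero uniformly on balls, THEN some hull element
`S₂ ∋ 0` of `x` is `δ`-separated, relatively dense and EVERYWHERE `1/20`-{fcc,hcp}-good.

The route inlines its `{fcc,hcp}`-goodness clause `GF S y`; it is, definitionally, the landed name
`Summit.AtomisticToContinuum.Crystallization.Theorems.SiteGood S y`
(`Theorems/HullExactificationCascadeHullGoodEverywhereDefs.lean`, an `Iff.rfl`-grade identity: same `d`,
same strict `13/10·d` shell, same two patterns, same closed tolerance `≤ 1/20`).  The stubs below are
stated with that name and with `Literature.MathematicalPhysics.StatisticalMechanics.BallMatch` (two-way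
`ε`-matching on a ball); everything else is inlined over tree declarations.  The alphabet hypothesis
`GA` and the ground-state hypothesis are not needed by the line (the stubs are pure point-set facts).

## The line: CLEAN CORES → HULL COMPACTNESS → CLOSEDNESS OF FIXED-TOLERANCE GOODNESS

Exactification no. 2 in the pattern of the PROVED `hullExactShells_proof` (item 12092), with the two
differences the grounder flagged made explicit as stubs: the SITE-DEPENDENT scale `d_y` and the CLOSED
tolerance `≤ 1/20` (no `η → 0` slack) must pass to local limits, and relative denseness must be carried.

* `stub_cleanCores` (M; pigeonhole + recentring) — zero density of the non-good points on balls,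
  `δ`-separation and relative denseness give, for every `n`, a point `y_n ∈ S` all of whose
  `S`-neighbours within `n` are good; the recentred sets `X n := S − y_n ∋ 0` are again `δ`-separated,
  uniformly relatively dense hull elements of `x`, good on the core `‖z‖ ≤ n` (goodness, separation,
  hull-ness and denseness are translation covariant).
* `stub_hullCompactness` (M; soft) — a sequence of `δ`-separated, uniformly relatively dense hull
  elements of `x`, each containing `0`, has a subsequence converging locally (two-way matching on every
  ball) to a `δ`-separated, relatively dense hull element `S₂ ∋ 0` of `x` (local compactness of
  uniformly discrete sets; limits of local limits of `x` are local limits of `x` — diagonal argument;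
  the root and the density radius survive).
* `stub_siteGoodOfLimit` (M/L; the load-bearing step) — FIXED-TOLERANCE GOODNESS IS CLOSED under local
  convergence of uniformly separated, uniformly relatively dense sets: if `X k → S₂` locally and every
  point of `X k` in the core `‖z‖ ≤ k` is `1/20`-good in `X k`, then every point of `S₂` is `1/20`-good
  in `S₂`.  Mechanism: the twelve pattern vectors are unit, so a good shell lies in the annulus
  `[19d/20, 21d/20]` and the open cutoff `13/10·d` is never approached (annular gap) — shells and
  nearest-neighbour distances `d` correspond exactly under fine matchings; isometries range in the
  compact `O(3)`, bijections with a finite pattern are finitely many, and `≤ 1/20` is closed.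

`HullGlue_of : HullGlue` is the kernel-checked composition (cores → compactness → closedness, the
subsequence re-indexing `k ≤ ψ k` done here); the hypothesis form
`stub₁-sig → stub₂-sig → stub₃-sig → HullGlue` is the sorry-free `example` right above it.  The only
`sorry`s of this file are the three `stub_*`.

Disproof.lean: none exists for this crux (`ledger crux ls stmt-AtomisticToContinuum-15802`: no workfiles
at registration) — nothing to honour.  Negatives index: the stubs are soft point-set topology facts
(no energy, no pattern inference from contact graphs), so no recorded witness (DecahedralSoftShell,
count-only soft kissing, stmt-4146) instantiates them.

Registered signatures are ONE-LINE and fully qualified (they must survive textual restatement in a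
`Theorems/`-side `--supports` file).
-/

noncomputable section

namespace Summit.AtomisticToContinuum.Crystallization.Cruxes.HullGlue.Birth

open Filter Topology

/-! ## Registered stubs (the ONLY `sorry`s of the file; one-line, fully qualified signatures) -/

/-- **STUB 1 — clean cores, recentred** (M; pigeonhole + translation covariance).  Let `S ⊆ ℝ³` be a
`δ`-separated (`δ > 0`), relatively dense hull element of the family `x` whose non-`SiteGood` points have
density zero uniformly on balls.  Then there are sets `X n ⊆ ℝ³` (`n : ℕ`) and one radius `R₁` such that
every `X n` is `δ`-separated, contains `0`, is a hull element of `x`, is `R₁`-dense, and every point of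
`X n` of norm `≤ n` is `SiteGood` in `X n`.  Intended proof: defect-free balls of radius `n + R₁ + 1`
(`HullExactShells.exists_ball_forall_not`, grid/pigeonhole) contain a point `y_n ∈ S` by denseness; put
`X n := (· + y_n) ⁻¹' S` and transport separation (`sep_preimage_add_const`), hull-ness
(`isLimit_preimage_add_const`), denseness and goodness (`SiteGood.translate`).  Why it might fail: only a
mis-transcription of the hull clause; the mathematics is banked. -/
theorem stub_cleanCores : ∀ (x : (N : ℕ) → (Fin N → EuclideanSpace ℝ (Fin 3))) (S : Set (EuclideanSpace ℝ (Fin 3))) (δ : ℝ), 0 < δ → (∀ y ∈ S, ∀ z ∈ S, y ≠ z → δ ≤ dist y z) → (∃ φ : ℕ → ℕ, StrictMono φ ∧ ∃ τ : ℕ → EuclideanSpace ℝ (Fin 3), ∀ R ε : ℝ, 0 < ε → ∀ᶠ j : ℕ in Filter.atTop, (∀ s ∈ S, ‖s‖ ≤ R → ∃ i : Fin (φ j), dist (x (φ j) i + τ j) s ≤ ε) ∧ (∀ i : Fin (φ j), ‖x (φ j) i + τ j‖ ≤ R → ∃ s ∈ S, dist (x (φ j) i + τ j) s ≤ ε)) →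 (∃ R₁ : ℝ, ∀ p : EuclideanSpace ℝ (Fin 3), ∃ y ∈ S, dist y p ≤ R₁) → (∀ θ : ℝ, 0 < θ → ∃ L₀ : ℝ, ∀ L : ℝ, L₀ ≤ L → ∀ c : EuclideanSpace ℝ (Fin 3), (({y : EuclideanSpace ℝ (Fin 3) | y ∈ S ∧ dist y c ≤ L ∧ ¬ Summit.AtomisticToContinuum.Crystallization.Theorems.SiteGood S y} : Set (EuclideanSpace ℝ (Fin 3))).ncard : ℝ) ≤ θ * L ^ 3) → ∃ X : ℕ → Set (EuclideanSpace ℝ (Fin 3)), ∃ R₁ : ℝ, ∀ n : ℕ, (∀ y ∈ X n, ∀ z ∈ X n, y ≠ z → δ ≤ dist y z) ∧ (0 : EuclideanSpace ℝ (Fin 3)) ∈ X n ∧ (∃ φ : ℕ → ℕ, StrictMono φ ∧ ∃ τ : ℕ → EuclideanSpace ℝ (Fin 3), ∀ R ε : ℝ, 0 < ε → ∀ᶠ j : ℕ in Filter.atTop, (∀ s ∈ X n, ‖s‖ ≤ R → ∃ i : Fin (φ j), dist (x (φ j) i + τ j) s ≤ ε) ∧ (∀ i : Fin (φ j), ‖x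 (φ j) i + τ j‖ ≤ R → ∃ s ∈ X n, dist (x (φ j) i + τ j) s ≤ ε)) ∧ (∀ p : EuclideanSpace ℝ (Fin 3), ∃ y ∈ X n, dist y p ≤ R₁) ∧ (∀ z ∈ X n, ‖z‖ ≤ (n : ℝ) → Summit.AtomisticToContinuum.Crystallization.Theorems.SiteGood (X n) z) := by
  sorry

/-- **STUB 2 — hull compactness with root and density** (M; soft).  A sequence `X n ⊆ ℝ³` of
`δ`-separated (`δ > 0`) hull elements of the family `x`, each containing `0` and each `R₁`-dense, has a
subsequence `X (ψ k)` converging locally — `BallMatch ε R 0 (X (ψ k)) S₂` eventually in `k`, for every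
`R` and every `ε > 0` — to a `δ`-separated `S₂ ∋ 0` which is again a hull element of `x` and is
`(R₁ + 1)`-dense.  Intended proof: `exists_subseq_forall_eventually_ballMatch` (Literature,
`LocalMatchingCompactness`), `HullExactShells.zero_mem_of_ballMatch`,
`HullExactShells.isLimit_of_eventually_ballMatch` (limits of local limits of `x` are local limits of `x`,
diagonal), and one matching step at tolerance `1` for the density radius.  Why it might fail: it does
not mathematically (folklore: Radin 1991 §2, Bellissard–Radin–Shlosman 2010 §2); only the bookkeeping of
the diagonal indices is delicate, and it is banked. -/
theorem stub_hullCompactness : ∀ (x : (N : ℕ) → (Fin N → EuclideanSpace ℝ (Fin 3))) (X : ℕ → Set (EuclideanSpace ℝ (Fin 3))) (δ R₁ : ℝ), 0 < δ → (∀ n : ℕ, ∀ y ∈ X n, ∀ z ∈ X n, y ≠ z → δ ≤ dist y z) → (∀ n : ℕ, (0 : EuclideanSpace ℝ (Fin 3)) ∈ X n) → (∀ n : ℕ, ∃ φ : ℕ → ℕ, StrictMono φ ∧ ∃ τ : ℕ → EuclideanSpace ℝ (Fin 3), ∀ R ε : ℝ, 0 < ε → ∀ᶠ j : ℕ in Filter.atTop,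 (∀ s ∈ X n, ‖s‖ ≤ R → ∃ i : Fin (φ j), dist (x (φ j) i + τ j) s ≤ ε) ∧ (∀ i : Fin (φ j), ‖x (φ j) i + τ j‖ ≤ R → ∃ s ∈ X n, dist (x (φ j) i + τ j) s ≤ ε)) → (∀ n : ℕ, ∀ p : EuclideanSpace ℝ (Fin 3), ∃ y ∈ X n, dist y p ≤ R₁) → ∃ ψ : ℕ → ℕ, StrictMono ψ ∧ ∃ S₂ : Set (EuclideanSpace ℝ (Fin 3)), (∀ y ∈ S₂, ∀ z ∈ S₂, y ≠ z → δ ≤ dist y z) ∧ (0 : EuclideanSpace ℝ (Fin 3)) ∈ S₂ ∧ (∃ φ : ℕ → ℕ, StrictMono φ ∧ ∃ τ : ℕ → EuclideanSpace ℝ (Fin 3), ∀ R ε : ℝ, 0 < ε → ∀ᶠ j : ℕ in Filter.atTop, (∀ s ∈ S₂, ‖s‖ ≤ R → ∃ i : Fin (φ j), dist (x (φ j) i + τ j) s ≤ ε) ∧ (∀ i : Fin (φ j), ‖x (φ j) i + τ j‖ ≤ R → ∃ s ∈ S₂, dist (x (φ j) i + τ j) s ≤ ε)) ∧ (∀ p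 : EuclideanSpace ℝ (Fin 3), ∃ y ∈ S₂, dist y p ≤ R₁ + 1) ∧ (∀ R ε : ℝ, 0 < ε → ∀ᶠ k : ℕ in Filter.atTop, Literature.MathematicalPhysics.StatisticalMechanics.BallMatch ε R 0 (X (ψ k)) S₂) := by
  sorry

/-- **STUB 3 — fixed-tolerance goodness is closed under local convergence** (M/L; load-bearing).  Let
`X k ⊆ ℝ³` be `δ`-separated (`δ > 0`) and `R₁`-dense, converging locally to the `δ`-separated `S₂`
(`BallMatch ε R 0 (X k) S₂` eventually in `k`, all `R`, `ε > 0`), and suppose every point of `X k` of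
norm `≤ k` is `SiteGood` in `X k`.  Then EVERY point of `S₂` is `SiteGood` in `S₂` — with the SAME closed
tolerance `1/20`, the SAME strict cutoff `13/10·d` and the site-dependent scale `d`.  Intended proof:
follow `y ∈ S₂` back along nearest approximants `p k → y` (`hge_exists_approx`), which are good for
large `k`; denseness bounds the scale (`d ≤ 2R₁ + 1`, `SiteGood.patternGood`); one of the two patterns
occurs frequently (`hge_frequently_or`); along that subsequence the landed closedness engine
`hge_patternGood_of_limit` (compactness of `O(3)`, finitely many labellings, unit pattern vectors ⇒
annular gap `[19d/20, 21d/20]` vs cutoff `13d/10`, closed `≤ 1/20`) gives `PatternGood` at `y`, hence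
`SiteGood` (`PatternGood.siteGood`).  Why it might fail: a boundary effect the engine does not cover —
a limit point of `S₂ ∖ {y}` at distance exactly `13/10·d_y` or a nearest-neighbour distance that jumps
in the limit; both are excluded by the annular gap, which is where the `1/20 < 3/10` margin is used. -/
theorem stub_siteGoodOfLimit : ∀ (X : ℕ → Set (EuclideanSpace ℝ (Fin 3))) (S₂ : Set (EuclideanSpace ℝ (Fin 3))) (δ R₁ : ℝ), 0 < δ → (∀ k : ℕ, ∀ y ∈ X k, ∀ z ∈ X k, y ≠ z → δ ≤ dist y z) → (∀ y ∈ S₂, ∀ z ∈ S₂, y ≠ z → δ ≤ dist y z) → (∀ k : ℕ, ∀ p : EuclideanSpace ℝ (Fin 3), ∃ y ∈ X k, dist y p ≤ R₁) → (∀ R ε : ℝ, 0 < ε → ∀ᶠ k : ℕ in Filter.atTop, Literature.MathematicalPhysics.StatisticalMechanics.BallMatch ε R 0 (X k) S₂) → (∀ k : ℕ, ∀ z ∈ X k, ‖z‖ ≤ (k : ℝ) → Summit.AtomisticToContinuum.Crystallization.Theorems.SiteGood (X k) z) → ∀ y ∈ S₂, Summit.AtomisticToContinuum.Crystallization.Theorems.SiteGood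 S₂ y := by
  sorry

/-! ## Composition (kernel-checked): the stubs imply the crux BY NAME -/

/-- HYPOTHESIS FORM (BC3 letter; sorry-free, real proof): the three stub STATEMENTS imply the crux —
clean cores, compactness, closedness of goodness along the extracted subsequence (`k ≤ ψ k`); the crux's
inlined `GF` clause is `SiteGood` definitionally.  Kept as an `example` so that `HullGlue_of` below is the
file's ONLY declaration concluding the crux by name (`#h21_check_skeleton` takes the first such
declaration and admits no inlined `Prop` binders). -/
example : (∀ (x : (N : ℕ) → (Fin N → EuclideanSpace ℝ (Fin 3))) (S : Set (EuclideanSpace ℝ (Fin 3))) (δ : ℝ), 0 < δ → (∀ y ∈ S, ∀ z ∈ S, y ≠ z → δ ≤ dist y z) → (∃ φ : ℕ → ℕ, StrictMono φ ∧ ∃ τ : ℕ → EuclideanSpace ℝ (Fin 3), ∀ R ε : ℝ, 0 < ε → ∀ᶠ j : ℕ in Filter.atTop, (∀ s ∈ S, ‖s‖ ≤ R → ∃ i : Fin (φ j), dist (x (φ j) i + τ j) s ≤ ε) ∧ (∀ i : Fin (φ j), ‖x (φ j) i + τ j‖ ≤ R → ∃ s ∈ S, dist (x (φ j) i + τ j)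 s ≤ ε)) → (∃ R₁ : ℝ, ∀ p : EuclideanSpace ℝ (Fin 3), ∃ y ∈ S, dist y p ≤ R₁) → (∀ θ : ℝ, 0 < θ → ∃ L₀ : ℝ, ∀ L : ℝ, L₀ ≤ L → ∀ c : EuclideanSpace ℝ (Fin 3), (({y : EuclideanSpace ℝ (Fin 3) | y ∈ S ∧ dist y c ≤ L ∧ ¬ Summit.AtomisticToContinuum.Crystallization.Theorems.SiteGood S y} : Set (EuclideanSpace ℝ (Fin 3))).ncard : ℝ) ≤ θ * L ^ 3) → ∃ X : ℕ → Set (EuclideanSpace ℝ (Fin 3)), ∃ R₁ : ℝ, ∀ n : ℕ, (∀ y ∈ X n, ∀ z ∈ X n, y ≠ z → δ ≤ dist y z) ∧ (0 : EuclideanSpace ℝ (Fin 3)) ∈ X n ∧ (∃ φ : ℕ → ℕ, StrictMono φ ∧ ∃ τ : ℕ → EuclideanSpace ℝ (Fin 3), ∀ R ε : ℝ, 0 < ε → ∀ᶠ j : ℕ in Filter.atTop, (∀ s ∈ X n, ‖s‖ ≤ R → ∃ i : Fin (φ j), dist (x (φ j) i + τ j) s ≤ ε) ∧ (∀ i : Fin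 (φ j), ‖x (φ j) i + τ j‖ ≤ R → ∃ s ∈ X n, dist (x (φ j) i + τ j) s ≤ ε)) ∧ (∀ p : EuclideanSpace ℝ (Fin 3), ∃ y ∈ X n, dist y p ≤ R₁) ∧ (∀ z ∈ X n, ‖z‖ ≤ (n : ℝ) → Summit.AtomisticToContinuum.Crystallization.Theorems.SiteGood (X n) z)) → (∀ (x : (N : ℕ) → (Fin N → EuclideanSpace ℝ (Fin 3))) (X : ℕ → Set (EuclideanSpace ℝ (Fin 3))) (δ R₁ : ℝ), 0 < δ → (∀ n : ℕ, ∀ y ∈ X n, ∀ z ∈ X n, y ≠ z → δ ≤ dist y z) → (∀ n : ℕ, (0 : EuclideanSpace ℝ (Fin 3)) ∈ X n) → (∀ n : ℕ, ∃ φ : ℕ → ℕ, StrictMono φ ∧ ∃ τ : ℕ → EuclideanSpace ℝ (Fin 3), ∀ R ε : ℝ, 0 < ε → ∀ᶠ j : ℕ in Filter.atTop, (∀ s ∈ X n, ‖s‖ ≤ R → ∃ i : Fin (φ j), dist (x (φ j) i + τ j) s ≤ ε) ∧ (∀ i : Fin (φ j), ‖x (φ j) i + τ j‖ ≤ R → ∃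 s ∈ X n, dist (x (φ j) i + τ j) s ≤ ε)) → (∀ n : ℕ, ∀ p : EuclideanSpace ℝ (Fin 3), ∃ y ∈ X n, dist y p ≤ R₁) → ∃ ψ : ℕ → ℕ, StrictMono ψ ∧ ∃ S₂ : Set (EuclideanSpace ℝ (Fin 3)), (∀ y ∈ S₂, ∀ z ∈ S₂, y ≠ z → δ ≤ dist y z) ∧ (0 : EuclideanSpace ℝ (Fin 3)) ∈ S₂ ∧ (∃ φ : ℕ → ℕ, StrictMono φ ∧ ∃ τ : ℕ → EuclideanSpace ℝ (Fin 3), ∀ R ε : ℝ, 0 < ε → ∀ᶠ j : ℕ in Filter.atTop, (∀ s ∈ S₂, ‖s‖ ≤ R → ∃ i : Fin (φ j), dist (x (φ j) i + τ j) s ≤ ε) ∧ (∀ i : Fin (φ j), ‖x (φ j) i + τ j‖ ≤ R → ∃ s ∈ S₂, dist (x (φ j) i + τ j) s ≤ ε)) ∧ (∀ p : EuclideanSpace ℝ (Fin 3), ∃ y ∈ S₂, dist y p ≤ R₁ + 1) ∧ (∀ R ε : ℝ, 0 < ε → ∀ᶠ k : ℕ in Filter.atTop, Literature.MathematicalPhysics.StatisticalMechanics.BallMatch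 ε R 0 (X (ψ k)) S₂)) → (∀ (X : ℕ → Set (EuclideanSpace ℝ (Fin 3))) (S₂ : Set (EuclideanSpace ℝ (Fin 3))) (δ R₁ : ℝ), 0 < δ → (∀ k : ℕ, ∀ y ∈ X k, ∀ z ∈ X k, y ≠ z → δ ≤ dist y z) → (∀ y ∈ S₂, ∀ z ∈ S₂, y ≠ z → δ ≤ dist y z) → (∀ k : ℕ, ∀ p : EuclideanSpace ℝ (Fin 3), ∃ y ∈ X k, dist y p ≤ R₁) → (∀ R ε : ℝ, 0 < ε → ∀ᶠ k : ℕ in Filter.atTop, Literature.MathematicalPhysics.StatisticalMechanics.BallMatch ε R 0 (X k) S₂) → (∀ k : ℕ, ∀ z ∈ X k, ‖z‖ ≤ (k : ℝ) → Summit.AtomisticToContinuum.Crystallization.Theorems.SiteGood (X k) z) → ∀ y ∈ S₂, Summit.AtomisticToContinuum.Crystallization.Theorems.SiteGood S₂ y) → Summit.AtomisticToContinuum.Crystallization.Theses.DisclinationRation.HullGlue := by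
  intro hA hB hC x hx S δ hδ hsep hHL hdense hGA hdens
  obtain ⟨X, R₁, hX⟩ := hA x S δ hδ hsep hHL hdense hdens
  obtain ⟨ψ, hψ, S₂, hsep₂, h0₂, hHL₂, hdense₂, hlim⟩ := hB x X δ R₁ hδ (fun n => (hX n).1) (fun n => (hX n).2.1) (fun n => (hX n).2.2.1) (fun n => (hX n).2.2.2.1)
  refine ⟨S₂, hsep₂, h0₂, hHL₂, ⟨R₁ + 1, hdense₂⟩, ?_⟩
  intro y hy
  exact hC (fun k => X (ψ k)) S₂ δ R₁ hδ (fun k => (hX (ψ k)).1) hsep₂ (fun k => (hX (ψ k)).2.2.2.1) hlim (fun k z hz hzk => (hX (ψ k)).2.2.2.2 z hz (hzk.trans (by exact_mod_cast hψ.le_apply))) y hy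

/-- THE SKELETON THEOREM (registered form, as `#h21_check_skeleton` requires: concludes the route decl
`HullGlue` BY NAME, no hypotheses, `sorry` only through the three declared `stub_*`):
`HullGlue_of = stub_siteGoodOfLimit ∘ stub_hullCompactness ∘ stub_cleanCores` (cores, extract, pass
goodness to the limit along `k ≤ ψ k`). -/
theorem HullGlue_of : Summit.AtomisticToContinuum.Crystallization.Theses.DisclinationRation.HullGlue := by
  intro x hx S δ hδ hsep hHL hdense hGA hdens
  obtain ⟨X, R₁, hX⟩ := stub_cleanCores x S δ hδ hsep hHL hdense hdens
  obtain ⟨ψ, hψ, S₂, hsep₂, h0₂, hHL₂, hdense₂, hlim⟩ := stub_hullCompactness x X δ R₁ hδ (fun n => (hX n).1) (fun n => (hX n).2.1) (fun n => (hX n).2.2.1) (fun n => (hX n).2.2.2.1)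
  refine ⟨S₂, hsep₂, h0₂, hHL₂, ⟨R₁ + 1, hdense₂⟩, ?_⟩
  intro y hy
  exact stub_siteGoodOfLimit (fun k => X (ψ k)) S₂ δ R₁ hδ (fun k => (hX (ψ k)).1) hsep₂ (fun k => (hX (ψ k)).2.2.2.1) hlim (fun k z hz hzk => (hX (ψ k)).2.2.2.2 z hz (hzk.trans (by exact_mod_cast hψ.le_apply))) y hy

/-! ## Sanity: the route's inlined `{fcc,hcp}`-goodness clause IS `SiteGood` (definitional) -/

example (S : Set (EuclideanSpace ℝ (Fin 3))) (y : EuclideanSpace ℝ (Fin 3)) :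
    Summit.AtomisticToContinuum.Crystallization.Theorems.SiteGood S y ↔ (let d : ℝ := sInf ((fun z => dist z y) '' (S \ {y})); let T : Set (EuclideanSpace ℝ (Fin 3)) := {z : EuclideanSpace ℝ (Fin 3) | z ∈ S ∧ z ≠ y ∧ dist z y < 13 / 10 * d}; ∃ A : EuclideanSpace ℝ (Fin 3) →ₗᵢ[ℝ] EuclideanSpace ℝ (Fin 3), (∃ e : ↥T ≃ ↥Literature.Geometry.DiscreteGeometry.fccKissingPattern, ∀ t : ↥T, dist (d⁻¹ • ((t : EuclideanSpace ℝ (Fin 3)) - y)) (A ((e t : ↥Literature.Geometry.DiscreteGeometry.fccKissingPattern) : EuclideanSpace ℝ (Fin 3))) ≤ 1 / 20) ∨ (∃ e : ↥T ≃ ↥Literature.Geometry.DiscreteGeometry.hcpKissingPattern, ∀ t : ↥T, dist (d⁻¹ • ((t : EuclideanSpace ℝ (Fin 3)) - y)) (A ((e t : ↥Literature.Geometry.DiscreteGeometry.hcpKissingPattern) : EuclideanSpace ℝ (Fin 3))) ≤ 1 / 20)) := Iff.rfl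

end Summit.AtomisticToContinuum.Crystallization.Cruxes.HullGlue.Birth

end
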